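import Literature.AlgebraicGeometry.GroupSchemes.BirationalGroupLawStrictification
import Literature.NumberTheory.EllipticCurves.NeronModel
import Mathlib.AlgebraicGeometry.Geometrically.Irreducible
import Mathlib.AlgebraicGeometry.Morphisms.Proper
import Mathlib.AlgebraicGeometry.Morphisms.Smooth
import HarnessLib

/-!
# The strict locus of a birational group law on a proper model contains the generic fibre

Topic `AlgebraicGeometry/GroupSchemes`, namespace `Literature.AlgebraicGeometry.GroupSchemes`.  THEOREMS ONLY (no
definition, no named fact, no instance, no `sorry`); vocabulary of `StrictBirationalGroupLaw` (`BirationalGroupLaw`,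
`IsFibrewiseDense`, `LawData.Computes`, `BirationalGroupLaw.IsStrict`) and of `BirationalGroupLawStrictification`
(Artin's strict locus `V′ = π₁(dom) ∩ π₂(dom) ∩ π₃(dom)`, `BirationalGroupLaw.exists_isStrict_on_strictLocus`).

Let `𝒳 → S` carry a birational group law `m : dom → 𝒳`, `dom ⊆ 𝒳 ×_S 𝒳`.  [Artin1986NeronModels] (2.2) replaces `𝒳`
by the open `V′` of points which occur as first coordinates, as second coordinates and as products of points of
`dom`; on `V′` the law is strict (Lemma 2.1 there; tree: `exists_isStrict_on_strictLocus`).  When a whole fibre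
`(𝒳 ×_S 𝒳)_t` lies in `dom` — for the law of [BLRNeronModels1990] §4.3 / [EdixhovenRomagny] Thm. 6.3 on a smooth
proper model this is the GENERIC fibre, where `m` is the honest group law of `𝒳_K` — the fibre `𝒳_t` consists of
first and of second coordinates of points of `dom` (pair a point with itself), and, if `𝒳 → S` is universally closed
and separated, ALSO of products: the shear `Φ = (pr₁, m) : dom → 𝒳 ×_S 𝒳` has fibrewise dense image, its graph is
closed over `dom` (separatedness) and the second projection `(𝒳 ×_S 𝒳) ×_S (𝒳 ×_S 𝒳) → 𝒳 ×_S 𝒳` is a closed map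
(universal closedness), so every point of `(𝒳 ×_S 𝒳)_t` is a value of `Φ` and every point `x` of `𝒳_t` is the product
`m(d)` with `Φ(d) = (x, x)` — the scheme-theoretic form of «`m_K : 𝒳_K × 𝒳_K → 𝒳_K` is surjective because
`(a, b) ↦ (a, ab)` is an open immersion of proper varieties, hence an isomorphism».  Hence `V′ ⊇ 𝒳_t`.

* `BirationalGroupLaw.fibre_subset_range_fst_dom`, `…_snd_dom` — a fibre of `𝒳 ×_S 𝒳` inside `dom` ⇒ the fibre of
  `𝒳` consists of first / second coordinates of points of `dom`;
* `BirationalGroupLaw.fibre_subset_range_shearLeft`, `BirationalGroupLaw.fibre_subset_range_mul` — … and (for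
  `𝒳 → S` universally closed and separated) of values of `Φ`, resp. of products;
* `strictOpenKeepsGenericFibre` — the form road W of the cell `hodgecm-mathlib` consumes (sub-line
  `koizumi_strictly_local`, slot `hB` of the composition `koizumiStrictlyLocal_of`): for `𝒳 → Spec R` smooth, proper,
  with geometrically irreducible fibres over a discrete valuation ring `R` with fraction field `K`, and a birational
  group law whose domain contains the generic fibre of `𝒳 ×_R 𝒳`, the strict open `X₀ = V′` CONTAINS THE GENERIC FIBRE
  of `𝒳`, meets the special fibre, is fibrewise dense, and carries a strict law with the same products.

Banked generic leaf toward `r₀` (Weil's group-chunk theorem for the Néron model); no floor change.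

## References
* [Artin1986NeronModels] M. Artin, *Néron models*, in Cornell–Silverman (eds.), *Arithmetic Geometry*, Springer 1986,
  §1 (1.11)–(1.12) p. 217 and §2, Lemma 2.1, (2.2) p. 221.
* [BLRNeronModels1990] S. Bosch, W. Lütkebohmert, M. Raynaud, *Néron Models*, Springer 1990, §4.3 Prop. 6, §5.2 Prop. 2.
* [EdixhovenRomagny] B. Edixhoven, M. Romagny, *Group schemes out of birational group laws, Néron models*,
  Panor. Synthèses 47 (2015) (arXiv:1204.1799), §3.2 and Thm. 6.3.
-/

set_option autoImplicit false

noncomputable section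

open CategoryTheory CategoryTheory.Limits AlgebraicGeometry MonoidalCategory CartesianMonoidalCategory
  TopologicalSpace Topology

namespace Literature.AlgebraicGeometry.GroupSchemes

universe u

/-! ### §1. The graph of a morphism defined on an open is closed over that open -/

section Graph

variable {X Y S : Scheme.{u}} (a : X ⟶ S) (b : Y ⟶ S) [IsSeparated b] (W : X.Opens)
  (g : (W : Scheme.{u}) ⟶ Y) (hw : W.ι ≫ a = g ≫ b)

/-- For `Y ⟶ S` separated, the range of the graph `(ι_W, g) : W ⟶ X ×_S Y` of a morphism `g` defined on an open
`W ⊆ X` is closed in `pr₁⁻¹(W)`: `closure (range γ) ∩ pr₁⁻¹(W) = range γ` (the graph is a section of the separated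
projection `pr₁⁻¹(W) ⟶ W`).  [folklore] -/
-- adapted from `Literature/AlgebraicGeometry/Morphisms/GraphClosure.lean` (private there)
private theorem closure_range_graph_inter_preimage_fst :
    closure (Set.range (pullback.lift W.ι g hw).base) ∩ (pullback.fst a b).base ⁻¹' (W : Set X) =
      Set.range (pullback.lift W.ι g hw).base := by
  set γ := pullback.lift W.ι g hw with hγ
  set O : (pullback a b).Opens := pullback.fst a b ⁻¹ᵁ W with hO
  have hγW : Set.range γ.base ⊆ (pullback.fst a b).base ⁻¹' (W : Set X) := by
    rintro _ ⟨w, rfl⟩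
    change (γ ≫ pullback.fst a b).base w ∈ (W : Set X)
    rw [hγ, pullback.lift_fst]
    exact w.2
  have hγO : Set.range γ.base ⊆ Set.range O.ι.base := by rw [Scheme.Opens.range_ι]; exact hγW
  -- the graph as a section `c` of the separated projection `q : pr₁⁻¹(W) ⟶ W`
  let c : (W : Scheme.{u}) ⟶ (O : Scheme.{u}) := IsOpenImmersion.lift O.ι γ hγO
  have hc : c ≫ O.ι = γ := IsOpenImmersion.lift_fac _ _ _
  have hcq : c ≫ (pullback.fst a b ∣_ W) = 𝟙 _ := by
    rw [← cancel_mono W.ι, Category.assoc, morphismRestrict_ι, ← Category.assoc, hc, hγ, pullback.lift_fst,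
      Category.id_comp]
  haveI : IsClosedImmersion (c ≫ (pullback.fst a b ∣_ W)) := by rw [hcq]; infer_instance
  haveI : IsClosedImmersion c := IsClosedImmersion.of_comp c (pullback.fst a b ∣_ W)
  have hcl : IsClosed (Set.range c.base) := c.isClosedEmbedding.isClosed_range
  -- transport closedness along the open embedding `pr₁⁻¹(W) ⊆ X ×_S Y`
  have hrange : Set.range γ.base = O.ι.base '' Set.range c.base := by
    rw [← hc, Scheme.Hom.comp_base, TopCat.coe_comp, Set.range_comp]
  apply subset_antisymm
  · rintro z ⟨hz, hzW⟩
    have hzO : z ∈ Set.range O.ι.base := by rw [Scheme.Opens.range_ι]; exact hzW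
    obtain ⟨o, rfl⟩ := hzO
    have ho : o ∈ O.ι.base ⁻¹' closure (O.ι.base '' Set.range c.base) := by rw [← hrange]; exact hz
    rw [O.ι.isOpenEmbedding.isOpenMap.preimage_closure_image O.ι.isOpenEmbedding.injective O.ι.continuous _
      hcl] at ho
    rw [hrange]
    exact Set.mem_image_of_mem _ ho
  · exact Set.subset_inter subset_closure hγW

end Graph

/-! ### §2. A fibre of `𝒳 ×_S 𝒳` inside the domain of definition -/

namespace BirationalGroupLaw

variable {S : Scheme.{u}} {𝒳 : Over S} (L : BirationalGroupLaw 𝒳)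

/-- If the fibre `(𝒳 ×_S 𝒳)_t` lies in `dom`, every point of `𝒳_t` is the FIRST coordinate of a point of `dom`
(namely of the diagonal point `(x, x)`). [cite: Artin1986NeronModels, (2.2) p. 221] -/
theorem fibre_subset_range_fst_dom {t : S}
    (ht : (𝒳 ⊗ 𝒳).hom.base ⁻¹' {t} ⊆ (L.dom : Set (𝒳 ⊗ 𝒳).left)) :
    𝒳.hom.base ⁻¹' {t} ⊆ Set.range (fun z : ↥L.dom => (fst 𝒳 𝒳).left.base (L.dom.ι.base z)) := by
  intro x hx
  have hδp : (𝒳 ⊗ 𝒳).hom.base ((lift (𝟙 𝒳) (𝟙 𝒳)).left.base x) = 𝒳.hom.base x := by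
    change ((lift (𝟙 𝒳) (𝟙 𝒳)).left ≫ (𝒳 ⊗ 𝒳).hom).base x = _; rw [Over.w (lift (𝟙 𝒳) (𝟙 𝒳))]
  have hmem : (lift (𝟙 𝒳) (𝟙 𝒳)).left.base x ∈ Set.range L.dom.ι.base := by
    rw [Scheme.Opens.range_ι]; exact ht (show (𝒳 ⊗ 𝒳).hom.base _ = t by rw [hδp]; exact hx)
  obtain ⟨z, hz⟩ := hmem
  refine ⟨z, ?_⟩
  change (fst 𝒳 𝒳).left.base (L.dom.ι.base z) = x
  rw [hz]
  change ((lift (𝟙 𝒳) (𝟙 𝒳) ≫ fst 𝒳 𝒳).left).base x = x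
  rw [lift_fst]
  rfl

/-- If the fibre `(𝒳 ×_S 𝒳)_t` lies in `dom`, every point of `𝒳_t` is the SECOND coordinate of a point of `dom`.
[cite: Artin1986NeronModels, (2.2) p. 221] -/
theorem fibre_subset_range_snd_dom {t : S}
    (ht : (𝒳 ⊗ 𝒳).hom.base ⁻¹' {t} ⊆ (L.dom : Set (𝒳 ⊗ 𝒳).left)) :
    𝒳.hom.base ⁻¹' {t} ⊆ Set.range (fun z : ↥L.dom => (snd 𝒳 𝒳).left.base (L.dom.ι.base z)) := by
  intro x hx
  have hδp : (𝒳 ⊗ 𝒳).hom.base ((lift (𝟙 𝒳) (𝟙 𝒳)).left.base x) = 𝒳.hom.base x := by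
    change ((lift (𝟙 𝒳) (𝟙 𝒳)).left ≫ (𝒳 ⊗ 𝒳).hom).base x = _; rw [Over.w (lift (𝟙 𝒳) (𝟙 𝒳))]
  have hmem : (lift (𝟙 𝒳) (𝟙 𝒳)).left.base x ∈ Set.range L.dom.ι.base := by
    rw [Scheme.Opens.range_ι]; exact ht (show (𝒳 ⊗ 𝒳).hom.base _ = t by rw [hδp]; exact hx)
  obtain ⟨z, hz⟩ := hmem
  refine ⟨z, ?_⟩
  change (snd 𝒳 𝒳).left.base (L.dom.ι.base z) = x
  rw [hz]
  change ((lift (𝟙 𝒳) (𝟙 𝒳) ≫ snd 𝒳 𝒳).left).base x = x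
  rw [lift_snd]
  rfl

/-- **A fibre of `𝒳 ×_S 𝒳` inside `dom` consists of values of the shear** `Φ = (pr₁, m)`, when `𝒳 → S` is
universally closed and separated: `Φ(dom)` is dense in the fibre, the second projection
`(𝒳 ×_S 𝒳) ×_S (𝒳 ×_S 𝒳) → 𝒳 ×_S 𝒳` is a closed map, and the graph of `Φ` is closed over `dom` — the scheme form
of «an open immersion of proper varieties with dense image is an isomorphism» applied to `Φ_t`.
[cite: Artin1986NeronModels, (1.11)–(1.12) p. 217 and (2.2) p. 221] [cite: BLRNeronModels1990, §4.3 Prop. 6] -/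
theorem fibre_subset_range_shearLeft [UniversallyClosed 𝒳.hom] [IsSeparated 𝒳.hom] {t : S}
    (ht : (𝒳 ⊗ 𝒳).hom.base ⁻¹' {t} ⊆ (L.dom : Set (𝒳 ⊗ 𝒳).left)) :
    (𝒳 ⊗ 𝒳).hom.base ⁻¹' {t} ⊆ Set.range L.shearLeft.left.base := by
  intro w hwt
  haveI : UniversallyClosed (fst 𝒳 𝒳).left := by
    change UniversallyClosed (pullback.fst 𝒳.hom 𝒳.hom); infer_instance
  haveI : IsSeparated (fst 𝒳 𝒳).left := by
    change IsSeparated (pullback.fst 𝒳.hom 𝒳.hom); infer_instance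
  haveI : UniversallyClosed (𝒳 ⊗ 𝒳).hom := by rw [← Over.w (fst 𝒳 𝒳)]; infer_instance
  haveI : IsSeparated (𝒳 ⊗ 𝒳).hom := by rw [← Over.w (fst 𝒳 𝒳)]; infer_instance
  -- `w` lies in the closure of `Φ(dom)`
  have hwcl : w ∈ closure (Set.range L.shearLeft.left.base) :=
    closure_mono Set.inter_subset_left (L.dense_shearLeft t hwt)
  -- the graph `γ = (ι_dom, Φ)` of `Φ` in `(𝒳 ⊗ 𝒳) ×_S (𝒳 ⊗ 𝒳)`
  have hΦ : L.dom.ι ≫ (𝒳 ⊗ 𝒳).hom = L.shearLeft.left ≫ (𝒳 ⊗ 𝒳).hom := (Over.w L.shearLeft).symm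
  have hγsnd : pullback.lift L.dom.ι L.shearLeft.left hΦ ≫ pullback.snd _ _ = L.shearLeft.left :=
    pullback.lift_snd _ _ _
  -- `pr₂` is a closed map: `pr₂ (closure (range γ)) ⊇ closure (Φ(dom)) ∋ w`
  have hsub : closure (Set.range L.shearLeft.left.base) ⊆
      (pullback.snd (𝒳 ⊗ 𝒳).hom (𝒳 ⊗ 𝒳).hom).base ''
        closure (Set.range (pullback.lift L.dom.ι L.shearLeft.left hΦ).base) := by
    refine ((pullback.snd (𝒳 ⊗ 𝒳).hom (𝒳 ⊗ 𝒳).hom).isClosedMap _ isClosed_closure).closure_subset_iff.mpr ?_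
    rintro _ ⟨d, rfl⟩
    refine ⟨(pullback.lift L.dom.ι L.shearLeft.left hΦ).base d, subset_closure ⟨d, rfl⟩, ?_⟩
    exact congrArg (fun f => f.base d) hγsnd
  obtain ⟨c, hc, hcw⟩ := hsub hwcl
  -- `c` lies over `dom`: its first coordinate is in the fibre over `t`
  have hc₁ : (pullback.fst (𝒳 ⊗ 𝒳).hom (𝒳 ⊗ 𝒳).hom).base c ∈ (L.dom : Set (𝒳 ⊗ 𝒳).left) := by
    apply ht
    have h : (𝒳 ⊗ 𝒳).hom.base ((pullback.fst (𝒳 ⊗ 𝒳).hom (𝒳 ⊗ 𝒳).hom).base c) =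
        (𝒳 ⊗ 𝒳).hom.base ((pullback.snd (𝒳 ⊗ 𝒳).hom (𝒳 ⊗ 𝒳).hom).base c) := by
      change (pullback.fst _ _ ≫ (𝒳 ⊗ 𝒳).hom).base c = (pullback.snd _ _ ≫ (𝒳 ⊗ 𝒳).hom).base c
      rw [pullback.condition]
    change (𝒳 ⊗ 𝒳).hom.base _ = t
    rw [h, hcw]
    exact hwt
  -- the graph is closed over `dom`, so `c = γ d` and `w = pr₂ c = Φ d`
  have hcγ : c ∈ Set.range (pullback.lift L.dom.ι L.shearLeft.left hΦ).base := by
    rw [← closure_range_graph_inter_preimage_fst (𝒳 ⊗ 𝒳).hom (𝒳 ⊗ 𝒳).hom L.dom L.shearLeft.left hΦ]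
    exact ⟨hc, hc₁⟩
  obtain ⟨d, rfl⟩ := hcγ
  have e1 : (pullback.snd (𝒳 ⊗ 𝒳).hom (𝒳 ⊗ 𝒳).hom).base
      ((pullback.lift L.dom.ι L.shearLeft.left hΦ).base d) = L.shearLeft.left.base d :=
    congrArg (fun f => f.base d) hγsnd
  exact ⟨d, e1.symm.trans hcw⟩

/-- **A fibre of `𝒳 ×_S 𝒳` inside `dom` ⇒ every point of `𝒳_t` is a PRODUCT** (`𝒳 → S` universally closed and
separated): `x = pr₂ (x, x) = pr₂ (Φ d) = m d`.  For the generic fibre of a smooth proper model this is the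
surjectivity of the honest group law `m_K`. [cite: Artin1986NeronModels, (2.2) p. 221]
[cite: BLRNeronModels1990, §4.3 Prop. 6] -/
theorem fibre_subset_range_mul [UniversallyClosed 𝒳.hom] [IsSeparated 𝒳.hom] {t : S}
    (ht : (𝒳 ⊗ 𝒳).hom.base ⁻¹' {t} ⊆ (L.dom : Set (𝒳 ⊗ 𝒳).left)) :
    𝒳.hom.base ⁻¹' {t} ⊆ Set.range L.mul.base := by
  intro x hx
  have hδp : (𝒳 ⊗ 𝒳).hom.base ((lift (𝟙 𝒳) (𝟙 𝒳)).left.base x) = 𝒳.hom.base x := by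
    change ((lift (𝟙 𝒳) (𝟙 𝒳)).left ≫ (𝒳 ⊗ 𝒳).hom).base x = _; rw [Over.w (lift (𝟙 𝒳) (𝟙 𝒳))]
  obtain ⟨d, hd⟩ := L.fibre_subset_range_shearLeft ht (show (𝒳 ⊗ 𝒳).hom.base _ = t by rw [hδp]; exact hx)
  refine ⟨d, ?_⟩
  rw [← L.snd_shearLeft_base d, hd]
  change ((lift (𝟙 𝒳) (𝟙 𝒳) ≫ snd 𝒳 𝒳).left).base x = x
  rw [lift_snd]
  rfl

end BirationalGroupLaw

/-! ### §3. Smooth proper models over a discrete valuation ring -/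

open Literature.NumberTheory.EllipticCurves

/-- **The strict locus keeps the generic fibre** (road W, slot `hB` of `koizumiStrictlyLocal_of`).  Let `R` be a
discrete valuation ring with fraction field `K`, `𝒳 → Spec R` smooth and proper with geometrically irreducible fibres,
and `L` a birational group law on `𝒳` whose domain contains the generic fibre of `𝒳 ×_R 𝒳`.  Then Artin's strict
open `X₀ = π₁(dom) ∩ π₂(dom) ∩ π₃(dom)` carries a STRICT birational group law `L₀` with the same products, CONTAINS
THE GENERIC FIBRE of `𝒳` (`fibre_subset_range_fst_dom` / `…_snd_dom` / `fibre_subset_range_mul` — the last by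
properness), meets the special fibre and is fibrewise dense (the fibres being irreducible).
[cite: Artin1986NeronModels, Lemma 2.1 and (2.2) p. 221] [cite: BLRNeronModels1990, §4.3 Prop. 6 and §5.2 Prop. 2]
[cite: EdixhovenRomagny, §3.2 and Thm. 6.3] -/
theorem strictOpenKeepsGenericFibre
    (R : Type u) [CommRing R] [IsDomain R] [IsDiscreteValuationRing R]
    (K : Type u) [Field K] [Algebra R K] [IsFractionRing R K]
    (𝒳 : Over (Spec (.of R))) [Smooth 𝒳.hom] [IsProper 𝒳.hom] [GeometricallyIrreducible 𝒳.hom]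
    (L : BirationalGroupLaw 𝒳)
    (hdom : (𝒳 ⊗ 𝒳).hom.base ⁻¹' Set.range (specGenericPoint R K).base ⊆ (L.dom : Set (𝒳 ⊗ 𝒳).left)) :
    ∃ (X₀ : 𝒳.left.Opens) (L₀ : BirationalGroupLaw (Over.mk (X₀.ι ≫ 𝒳.hom))), L₀.IsStrict ∧
      𝒳.hom.base ⁻¹' Set.range (specGenericPoint R K).base ⊆ (X₀ : Set 𝒳.left) ∧
      ((X₀ : Set 𝒳.left) ∩ 𝒳.hom.base ⁻¹' {IsLocalRing.closedPoint R}).Nonempty ∧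
      IsFibrewiseDense 𝒳.hom (X₀ : Set 𝒳.left) ∧
      -- `L₀.mul` agrees with `L.mul`: on `T`-points (A-p06's `Strictification` clause)
      (∀ {T : Scheme.{u}} (q₀ : T ⟶ (L₀.dom : Scheme.{u})) (q : T ⟶ (L.dom : Scheme.{u}))
          (a b c₀ c : T ⟶ (X₀ : Scheme.{u})),
          LawData.Computes (Over.mk (X₀.ι ≫ 𝒳.hom)) L₀.dom L₀.mul q₀ a b c₀ →
          LawData.Computes 𝒳 L.dom L.mul q (a ≫ X₀.ι) (b ≫ X₀.ι) (c ≫ X₀.ι) → c₀ = c) := by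
  -- openness and irreducibility inputs
  haveI : UniversallyOpen (fst 𝒳 𝒳).left := by
    change UniversallyOpen (pullback.fst 𝒳.hom 𝒳.hom); infer_instance
  haveI : UniversallyOpen (snd 𝒳 𝒳).left := by
    change UniversallyOpen (pullback.snd 𝒳.hom 𝒳.hom); infer_instance
  haveI : GeometricallyIrreducible (fst 𝒳 𝒳).left := by
    change GeometricallyIrreducible (pullback.fst 𝒳.hom 𝒳.hom); infer_instance
  haveI : GeometricallyIrreducible (snd 𝒳 𝒳).left := by
    change GeometricallyIrreducible (pullback.snd 𝒳.hom 𝒳.hom); infer_instance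
  haveI : UniversallyOpen (𝒳 ⊗ 𝒳).hom := by rw [← Over.w (fst 𝒳 𝒳)]; infer_instance
  haveI : GeometricallyIrreducible (𝒳 ⊗ 𝒳).hom := by
    rw [← Over.w (fst 𝒳 𝒳)]; exact GeometricallyIrreducible.comp _ _
  have hirr : ∀ s : Spec (.of R), IsPreirreducible (𝒳.hom.base ⁻¹' {s}) := fun s =>
    (𝒳.hom.isIrreducible_preimage 𝒳.hom.isOpenMap isIrreducible_singleton).isPreirreducible
  have hirrS : ∀ s : Spec (.of R), IsPreirreducible ((𝒳 ⊗ 𝒳).hom.base ⁻¹' {s}) := fun s =>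
    ((𝒳 ⊗ 𝒳).hom.isIrreducible_preimage (𝒳 ⊗ 𝒳).hom.isOpenMap isIrreducible_singleton).isPreirreducible
  have hirr₁ : ∀ a : 𝒳.left, IsPreirreducible ((fst 𝒳 𝒳).left.base ⁻¹' {a}) := fun a =>
    ((fst 𝒳 𝒳).left.isIrreducible_preimage (fst 𝒳 𝒳).left.isOpenMap isIrreducible_singleton).isPreirreducible
  have hirr₂ : ∀ a : 𝒳.left, IsPreirreducible ((snd 𝒳 𝒳).left.base ⁻¹' {a}) := fun a =>
    ((snd 𝒳 𝒳).left.isIrreducible_preimage (snd 𝒳 𝒳).left.isOpenMap isIrreducible_singleton).isPreirreducible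
  -- Artin's strict locus
  obtain ⟨V, hV, L₀, hL₀, hagree⟩ :=
    L.exists_isStrict_on_strictLocus (fst 𝒳 𝒳).left.isOpenMap (snd 𝒳 𝒳).left.isOpenMap hirrS hirr₁ hirr₂
  have hdense : IsFibrewiseDense 𝒳.hom (V : Set 𝒳.left) := by
    rw [hV]; exact L.isFibrewiseDense_strictLocus (fst 𝒳 𝒳).left.isOpenMap (snd 𝒳 𝒳).left.isOpenMap hirr
  refine ⟨V, L₀, hL₀, ?_, ?_, hdense, hagree⟩
  · -- the generic fibre: first coordinates, second coordinates (diagonal points) and products (properness)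
    intro x hx
    have ht : (𝒳 ⊗ 𝒳).hom.base ⁻¹' {𝒳.hom.base x} ⊆ (L.dom : Set (𝒳 ⊗ 𝒳).left) := fun w hw =>
      hdom (show (𝒳 ⊗ 𝒳).hom.base w ∈ Set.range (specGenericPoint R K).base by
        rw [Set.mem_singleton_iff.mp hw]; exact hx)
    rw [hV]
    exact ⟨⟨L.fibre_subset_range_fst_dom ht rfl, L.fibre_subset_range_snd_dom ht rfl⟩,
      L.fibre_subset_range_mul ht rfl⟩
  · -- the special fibre is non-empty (`𝒳 → Spec R` is surjective) and `V` is dense in it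
    obtain ⟨x₀, hx₀⟩ := 𝒳.hom.surjective (IsLocalRing.closedPoint R)
    exact hdense.nonempty_inter_fibre ⟨x₀, hx₀⟩

end Literature.AlgebraicGeometry.GroupSchemes

end
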